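import Mathlib
import Summits.Ventures.PercRepro2.LocRows
import Summits.Ventures.PercRepro2.SwRow
import Summits.Ventures.PercRepro2.SwOut
import Summits.Ventures.PercRepro2.SwAllRow
import Summits.Ventures.PercRepro2.SwOutAll
import Summits.Ventures.PercRepro2.SwOutArmFlip
import Summits.Ventures.PercRepro2.SwOutArmThm
import Summits.Ventures.PercRepro2.SwOutCoreDefs
import Summits.Ventures.PercRepro2.SwOutCoreHull
import Summits.Ventures.PercRepro2.SwOutCoreDual
import Summits.Ventures.PercRepro2.SwOutEdgeDefs
import Summits.Ventures.PercRepro2.SwOutEdgeHull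

/-!
# The e-core cube: colour symmetry and the clusters of `l` (blind cell PercRepro2, night-4 g16,
2026-08-26; proofs/NIGHT4-G15.md §4 (L1–L3), proofs/NIGHT4-G16.md §1)

The DUAL base `dualBaseE ζ` — the dual base of the arms (`dualBase`) with the h–u edges kept red —
is again an e-core base with the same arms (`CoreBaseE.dual`), and the blue colouring of a cube
point is the dual realisation of the flipped point (`blue_coreRealE`); hence the blue cluster of
`h` of a cube point is `redSetE (flipAll ω)` (`cluster_blue_coreRealE`).  Going down the cube
recolours only edges touching the red envelope `redAll`, which is red-closed and avoids `l`, so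
the red cluster of `l` only grows (`cluster_l_coreRealE_anti`: every red edge at the red cluster of
`l` keeps its colour) and, by duality, the blue cluster of `l` only shrinks
(`cluster_blue_l_coreRealE_mono`) — the monotonicity of the conditioning `Q` along the cube.
Every cube point stays in the outside class (`coreRealE_mem_outClass`).
-/

namespace Summit.Ventures.PercRepro2

namespace LocRows

open Hull

variable {V : Type*} {E : Type*}

open scoped Classical

variable {ends : E → Sym2 V}

/-- The red cluster of `l` grows when every red edge at it stays red. -/
lemma cluster_l_subset_of_red_stays {ζ' ζ'' : Config E} {l : V}
    (hE : ∀ e x y, ends e = s(x, y) → x ∈ cluster ends ζ' l → ζ' e = true → ζ'' e = true) :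
    cluster ends ζ' l ⊆ cluster ends ζ'' l := by
  intro v hv
  refine (mem_of_conn_of_closed (ends := ends) (ω := ζ')
    (S := {x | x ∈ cluster ends ζ' l ∧ x ∈ cluster ends ζ'' l}) ?_
    ⟨mem_cluster_self _ _ _, mem_cluster_self _ _ _⟩ hv).2
  intro a ha b hab
  obtain ⟨_, e, he, hends⟩ := openGraph_adj.1 hab
  exact ⟨mem_cluster_of_edge ha.1 he hends, mem_cluster_of_edge ha.2 (hE e a b hends ha.1 he) hends⟩

section Dual

variable {ι : Type*} {A : ι → Set V} {pure : ι → Prop} {ζ : Config E} {h u : V} {H : Set V}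
  (hb : CoreBaseE ends ζ h u H A pure)
include hb

/-- A vertex of the red cluster of `l` (`l ∉ H`) lies outside the red envelope. -/
lemma CoreBaseE.notMem_redAll_of_mem_cluster_l {l : V} (hl : l ∉ H) {ω : Config (Option ι)}
    {x : V} (hx : x ∈ cluster ends (coreRealE ends A h u ζ ω) l) :
    x ∉ redAll A h u (ω ∘ some) := fun hxR =>
  hl (hb.redAll_subset ω (mem_of_conn_of_closed (hb.redAll_closed ω) hxR (conn_symm hx)))

/-- **The red cluster of `l` grows going down the cube** (`l ∉ H`). -/
theorem CoreBaseE.cluster_l_coreRealE_anti {l : V} (hl : l ∉ H) {ω ω' : Config (Option ι)}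
    (hω : ω ≤ ω') :
    cluster ends (coreRealE ends A h u ζ ω') l ⊆ cluster ends (coreRealE ends A h u ζ ω) l := by
  refine cluster_l_subset_of_red_stays (fun e x y hxy hx he => ?_)
  have hxR : x ∉ redAll A h u (ω' ∘ some) := hb.notMem_redAll_of_mem_cluster_l hl hx
  have hyR : y ∉ redAll A h u (ω' ∘ some) := fun hyR =>
    hxR (mem_of_conn_of_closed (hb.redAll_closed ω') hyR
      (conn_of_openAdj ⟨e, he, ends_swap hxy⟩))
  -- neither end is `h`, `u` or in a red arm of `ω'`
  by_cases hhu : ends e = s(h, u)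
  · exfalso
    rw [hxy, Sym2.eq_iff] at hhu
    rcases hhu with ⟨hxh, _⟩ | ⟨hxu, _⟩
    · exact hxR (by rw [mem_redAll_iff]; exact Or.inl hxh)
    · exact hxR (by rw [mem_redAll_iff]; exact Or.inr (Or.inl hxu))
  by_cases hA : e ∈ touches ends (allArms A)
  · obtain ⟨i, z, w, hzw, hz⟩ := CoreBase.exists_arm_of_touches_allArms hA
    -- `z ∈ {x, y}` lies in `A i`, so `A i` is blue at `ω'`, hence at `ω`
    have hzR : z ∉ redAll A h u (ω' ∘ some) := by
      rw [hxy, Sym2.eq_iff] at hzw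
      rcases hzw with ⟨hxz, _⟩ | ⟨_, hyz⟩
      · rw [← hxz]; exact hxR
      · rw [← hyz]; exact hyR
    have hi' : ω' (some i) = false := by
      by_contra hi
      simp only [Bool.not_eq_false] at hi
      exact hzR (by rw [mem_redAll_iff]; exact Or.inr (Or.inr ⟨i, hi, hz⟩))
    have hi : ω (some i) = false := by
      have := hω (some i)
      rw [hi'] at this
      cases h' : ω (some i)
      · rfl
      · rw [h'] at this; exact absurd this (by simp)
    rw [hb.coreRealE_apply_of_mem hzw hz, if_neg (by rw [hi]; decide)]
    rw [hb.coreRealE_apply_of_mem hzw hz, if_neg (by rw [hi']; decide)] at he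
    exact he
  · rw [CoreBaseE.coreRealE_apply_of_notMem hA hhu]
    rw [CoreBaseE.coreRealE_apply_of_notMem hA hhu] at he
    exact he

omit hb in
/-- The dual base: the dual base of the arms, with the h–u edges kept red. -/
noncomputable def dualBaseE (ends : E → Sym2 V) (A : ι → Set V) (h u : V) (ζ : Config E) :
    Config E :=
  fun e => if ends e = s(h, u) then ζ e else dualBase ends A ζ e

omit hb in
/-- The dual base on an h–u edge: the base colour. -/
lemma dualBaseE_apply_hu {e : E} (he : ends e = s(h, u)) : dualBaseE ends A h u ζ e = ζ e := by
  simp only [dualBaseE, if_pos he]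

omit hb in
/-- The dual base on an edge touching an arm: the base colour. -/
lemma dualBaseE_apply_of_mem {e : E} (he : e ∈ touches ends (allArms A)) (hhu : ends e ≠ s(h, u)) :
    dualBaseE ends A h u ζ e = ζ e := by
  simp only [dualBaseE, if_neg hhu, dualBase_apply_of_mem he]

omit hb in
/-- The dual base on an edge touching no arm that is not an h–u edge: the opposite colour. -/
lemma dualBaseE_apply_of_notMem {e : E} (he : e ∉ touches ends (allArms A))
    (hhu : ends e ≠ s(h, u)) : dualBaseE ends A h u ζ e = !ζ e := by
  simp only [dualBaseE, if_neg hhu, dualBase_apply_of_notMem he]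

/-- An edge inside `A i ∪ {v}` (`v = h` or `v = u`) touches an arm. -/
lemma CoreBaseE.touches_allArms_of_within {i : ι} {v : V} (hv : v = h ∨ v = u) {e : E}
    (he : e ∈ within ends (A i ∪ {v})) : e ∈ touches ends (allArms A) := by
  obtain ⟨x, hx, y, hy, hxy⟩ := he
  rcases hx with hx | hx
  · exact ⟨x, ⟨i, hx⟩, y, hxy⟩
  · rcases hy with hy | hy
    · exact ⟨y, ⟨i, hy⟩, x, ends_swap hxy⟩
    · exfalso
      rw [Set.mem_singleton_iff] at hx hy
      subst hx; subst hy
      rcases hv with rfl | rfl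
      · exact hb.loop_h e hxy
      · exact hb.loop_u e hxy

/-- An edge inside `A i ∪ {v}` is not an h–u edge. -/
lemma CoreBaseE.not_hu_of_within {i : ι} {v : V} {e : E} (he : e ∈ within ends (A i ∪ {v})) :
    ends e ≠ s(h, u) := by
  intro hhu
  obtain ⟨x, hx, y, hy, hxy⟩ := he
  rw [hhu, Sym2.eq_iff] at hxy
  rcases hxy with ⟨rfl, rfl⟩ | ⟨rfl, rfl⟩
  · rcases hx with hx | hx
    · exact hb.h_notMem_arm i hx
    · rcases hy with hy | hy
      · exact hb.u_notMem_arm i hy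
      · rw [Set.mem_singleton_iff] at hx hy
        exact hb.hne (hx.trans hy.symm)
  · rcases hx with hx | hx
    · exact hb.u_notMem_arm i hx
    · rcases hy with hy | hy
      · exact hb.h_notMem_arm i hy
      · rw [Set.mem_singleton_iff] at hx hy
        exact hb.hne (hy.trans hx.symm)

/-- The inside colourings of the arms are the same for the dual base. -/
lemma CoreBaseE.insideConfig_dualBaseE {i : ι} {v : V} (hv : v = h ∨ v = u) :
    insideConfig ends (A i ∪ {v}) (dualBaseE ends A h u ζ) = insideConfig ends (A i ∪ {v}) ζ := by
  funext e
  simp only [insideConfig]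
  by_cases he : e ∈ within ends (A i ∪ {v})
  · rw [dualBaseE_apply_of_mem (hb.touches_allArms_of_within hv he) (hb.not_hu_of_within he)]
  · rw [decide_eq_false he]
    simp

/-- **The dual base is an e-core base** with the same arms. -/
theorem CoreBaseE.dual : CoreBaseE ends (dualBaseE ends A h u ζ) h u H A pure where
  hne := hb.hne
  h_mem := hb.h_mem
  u_mem := hb.u_mem
  hu_exists := hb.hu_exists
  bdry_blue := by
    intro e x y hxy hxH hyH
    by_cases hhu : ends e = s(h, u)
    · exfalso
      rw [hxy, Sym2.eq_iff] at hhu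
      rcases hhu with ⟨_, rfl⟩ | ⟨_, rfl⟩
      · exact hyH hb.u_mem
      · exact hyH hb.h_mem
    by_cases he : e ∈ touches ends (allArms A)
    · rw [dualBaseE_apply_of_mem he hhu]; exact hb.bdry_blue e x y hxy hxH hyH
    · exfalso
      -- `x` is in no arm, so `x = h` or `x = u`, whose edges all stay in `H`
      have hxA : ∀ i, x ∉ A i := fun i hx => he ⟨x, ⟨i, hx⟩, y, hxy⟩
      by_cases hxh : x = h
      · subst hxh
        rcases hb.h_edges e y hxy with rfl | ⟨j, hyj⟩
        · exact hyH hb.u_mem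
        · exact hyH (hb.arm_sub j y hyj).1
      by_cases hxu : x = u
      · subst hxu
        rcases hb.u_edges e y hxy with rfl | ⟨j, hyj⟩
        · exact hyH hb.h_mem
        · exact hyH (hb.arm_sub j y hyj).1
      obtain ⟨i, hxi⟩ := hb.arm_cover x hxH hxh hxu
      exact hxA i hxi
  arm_sub := hb.arm_sub
  arm_nonempty := hb.arm_nonempty
  arm_disj := hb.arm_disj
  arm_cover := hb.arm_cover
  no_cross := hb.no_cross
  h_edges := hb.h_edges
  h_red := by
    intro e x hxe
    rcases hb.h_edges e x hxe with rfl | ⟨j, hxj⟩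
    · rw [dualBaseE_apply_hu hxe]; exact hb.h_red e x hxe
    · rw [dualBaseE_apply_of_mem (CoreBase.touches_allArms_of_mem (ends_swap hxe) hxj)
        (hb.not_hu_of_mem (ends_swap hxe) hxj)]
      exact hb.h_red e x hxe
  u_edges := hb.u_edges
  u_red := by
    intro e x hxe
    rcases hb.u_edges e x hxe with rfl | ⟨j, hxj⟩
    · rw [dualBaseE_apply_hu (by rw [hxe, Sym2.eq_swap])]; exact hb.u_red e x hxe
    · rw [dualBaseE_apply_of_mem (CoreBase.touches_allArms_of_mem (ends_swap hxe) hxj)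
        (hb.not_hu_of_mem (ends_swap hxe) hxj)]
      exact hb.u_red e x hxe
  harm_conn := by
    intro i hpi x hx
    rw [hb.insideConfig_dualBaseE (Or.inl rfl)]
    exact hb.harm_conn i hpi x hx
  pure_conn := by
    intro i hpi x hx
    rw [hb.insideConfig_dualBaseE (Or.inr rfl)]
    exact hb.pure_conn i hpi x hx
  pure_no_h := hb.pure_no_h

/-- **The blue colouring of a cube point is the dual realisation of the flipped point.** -/
theorem CoreBaseE.blue_coreRealE (ω : Config (Option ι)) :
    blue (coreRealE ends A h u ζ ω) = coreRealE ends A h u (dualBaseE ends A h u ζ) (flipAll ω) := by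
  funext e
  by_cases hhu : ends e = s(h, u)
  · rw [blue_apply, CoreBaseE.coreRealE_apply_hu (A := A) (ζ := ζ) hhu,
      CoreBaseE.coreRealE_apply_hu (A := A) (ζ := dualBaseE ends A h u ζ) hhu,
      dualBaseE_apply_hu hhu]
    cases hω : ω none <;> simp [flipAll, hω]
  by_cases he : e ∈ touches ends (allArms A)
  · obtain ⟨i, x, y, hxy, hx⟩ := CoreBase.exists_arm_of_touches_allArms he
    rw [blue_apply, hb.coreRealE_apply_of_mem hxy hx, hb.dual.coreRealE_apply_of_mem hxy hx,
      dualBaseE_apply_of_mem he hhu]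
    cases hωi : ω (some i) <;> simp [flipAll, hωi]
  · rw [blue_apply, CoreBaseE.coreRealE_apply_of_notMem he hhu,
      CoreBaseE.coreRealE_apply_of_notMem he hhu, dualBaseE_apply_of_notMem he hhu]

/-- **The blue cluster of `h` of a cube point**: `redSetE` of the flipped point. -/
theorem CoreBaseE.cluster_blue_coreRealE (ω : Config (Option ι)) :
    cluster ends (blue (coreRealE ends A h u ζ ω)) h = redSetE ends A h u pure (flipAll ω) := by
  rw [hb.blue_coreRealE]
  exact hb.dual.cluster_coreRealE (flipAll ω)

/-- **The blue cluster of `l` shrinks going down the cube** (`l ∉ H`). -/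
theorem CoreBaseE.cluster_blue_l_coreRealE_mono {l : V} (hl : l ∉ H) {ω ω' : Config (Option ι)}
    (hω : ω ≤ ω') :
    cluster ends (blue (coreRealE ends A h u ζ ω)) l ⊆
      cluster ends (blue (coreRealE ends A h u ζ ω')) l := by
  rw [hb.blue_coreRealE, hb.blue_coreRealE]
  exact hb.dual.cluster_l_coreRealE_anti hl (flipAll_le_flipAll hω)

/-- The hull of `h` of every cube point lies in `H`. -/
theorem CoreBaseE.hull_coreRealE_subset (ω : Config (Option ι)) :
    hull ends (coreRealE ends A h u ζ ω) h ⊆ H := by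
  intro x hx
  rcases hx with hx | hx
  · exact hb.cluster_coreRealE_subset ω hx
  · rw [hb.blue_coreRealE] at hx
    exact hb.dual.cluster_coreRealE_subset (flipAll ω) hx

/-- A realisation agrees with the base off the edges touching `H`. -/
lemma CoreBaseE.coreRealE_apply_of_not_touches_H {ω : Config (Option ι)} {e : E}
    (he : e ∉ touches ends H) : coreRealE ends A h u ζ ω e = ζ e := by
  apply CoreBaseE.coreRealE_apply_of_notMem
  · rintro ⟨x, ⟨i, hx⟩, y, hxy⟩
    exact he ⟨x, (hb.arm_sub i x hx).1, y, hxy⟩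
  · intro hhu
    exact he ⟨h, hb.h_mem, u, hhu⟩

/-- **Every cube point lies in the outside class** of the base (`H ⊆ U`). -/
theorem CoreBaseE.coreRealE_mem_outClass [Fintype E] [DecidableEq E] {U : Set V} {ξ : Config E}
    (hHU : H ⊆ U) (hζ : ζ ∈ outClass ends U h ξ) (ω : Config (Option ι)) :
    coreRealE ends A h u ζ ω ∈ outClass ends U h ξ := by
  rw [mem_outClass] at hζ ⊢
  refine ⟨fun e he => ?_, (hb.hull_coreRealE_subset ω).trans hHU⟩
  rw [hb.coreRealE_apply_of_not_touches_H (fun h' => he (touches_mono hHU h'))]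
  exact hζ.1 e he

end Dual

end LocRows

end Summit.Ventures.PercRepro2
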